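import Literature.AnabelianGeometry.SemiGraphs.AmbientVocabProp43iii
import Literature.AnabelianGeometry.SemiGraphs.AmbientVocabReal
import Literature.AnabelianGeometry.SemiGraphs.ProfiniteSemiGraphIsoTransportCharts

/-!
# [SemiAnbd] Prop 4.3 (iii) UNCONDITIONALLY at the parameter-free real vocabulary `SemiAnbdVocab.real`

Mochizuki, *Semi-graphs of anabelioids*, Publ. RIMS **42** (2006), §4 Prop 4.3 (iii) p.53: "a morphism
from a finite open object to a tempered object is not an isomorphism of semi-graphs of anabelioids";
proof p.53 (kurims `paper:url-f33ace170ff4`): a finite open object has a non-isolated open `𝔾`-closed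
edge, whereas a tempered covering lies over a PROPER morphism of semi-graphs (Def 3.5 (i)(ii) p.37:
the covering `𝒢_S → 𝒢` of an object `S` of `B^cov(𝒢)`; §1 p.14: proper = verticial cardinalities of
edges are preserved). [cite: MochizukiSemiAnbd2006, Prop 4.3 (iii), p. 53]

PROOF-ONLY (abc-iut-L3-t3 lineage, gen 10; MERGE-MAP.md §4 item 5 «§4–§5 statements at the real
vocabulary»; no definition, no instance, nothing restated).  abc-iut-L3-t7 gen 4 proved Prop 4.3 (iii)
at `SemiAnbdVocab.ofReal R` for every bridge residual `R` whose tempered arrows lie over proper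
morphisms of semi-graphs (`Loc.basicPropertiesStatementIII_ofReal_of_proper`, file
`AmbientVocabProp43iii.lean`) — the one law of print's tempered coverings that the proof consumes,
carried as a hypothesis because the residual was then still free.  Since gen 5 the residual is
INSTANTIATED (`SemiAnbdVocab.real`, `AmbientVocabReal.lean`: tempered arrows :=
`SgA.IsTemperedArrow` = finite étale ∨ `IsTemperedCoveringOf`, Def 3.5 (ii) read through the
t1 → t2 presentation bridge B1–B4), and the law is a THEOREM there:

* `ProfiniteSemiGraph.CovObj.isSome_coveringAbuts_iff`, `CovObj.isProper_coveringHom` — for ANY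
  object `S` of abc-iut-L3-t2/d6's `B^cov(𝒢)`, the covering `𝒢_S → 𝒢` (`CovObj.coveringHom`) lies over a
  proper morphism of semi-graphs: a branch-orbit `(b, ω)` abuts to a vertex-orbit iff `b` abuts to a
  vertex, and the branches of the edge-orbit `(e, ω)` are the branches of `e` tagged by `ω`;
* `SgAQuot.SgA.isProper_of_isTemperedCoveringOf` — an arrow of `SgA` realised, over `G.toProfinite`,
  by an object of `B^cov` (an `IsoOver` to its covering) lies over a proper morphism: its base factors
  as an ISOMORPHISM of semi-graphs (proper, `SemiGraph.vertCard_edgeMap_of_isIso`, abc-iut-L3-d6)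
  followed by `coveringHom.base`;
* `SgAQuot.SgA.isProper_of_isTemperedArrow` — with t7's `isProper_of_finiteEtale` for the other
  disjunct;
* ★ `Loc.basicPropertiesStatementIII_real` — **Prop 4.3 (iii) at `SemiAnbdVocab.real` for every
  `(𝔾, Γ)`, conditional on nothing** (`SemiAnbdVocab.real_eq_ofReal` is `rfl`).

Honest scope: one universe (`SgA.{u,u,u}`, as `SemiAnbdVocab.real`).  Nothing here takes a side on
[IUTchIII] Cor. 3.12; typed ≠ proved for the other §§4–5 statements.
-/

noncomputable section

namespace Literature.AnabelianGeometry.SemiGraphs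

open CategoryTheory

universe u

/-! ### The covering `𝒢_S → 𝒢` of an object of `B^cov(𝒢)` is proper -/

namespace ProfiniteSemiGraph.CovObj

variable {𝒢 : ProfiniteSemiGraph.{u}} (S : CovObj 𝒢)

/-- In the covering semi-graph `𝒢_S` of `S ∈ B^cov(𝒢)` ([SemiAnbd] Def 3.5 (i) p.37), the branch-orbit
`(b, ω)` abuts to some vertex-orbit iff the branch `b` of `𝒢` abuts to some vertex.
[cite: MochizukiSemiAnbd2006, Def 3.5(i) p.37] -/
theorem isSome_coveringAbuts_iff (b : 𝒢.graph.Branch) (ω : BTemp.Orbits (S.SE (𝒢.graph.edgeOf b))) :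
    (S.coveringSemiGraph.abuts ⟨b, ω⟩).isSome ↔ (𝒢.graph.abuts b).isSome := by
  have key : ∀ (o : Option 𝒢.graph.Vertex) (ho : 𝒢.graph.abuts b = o),
      (S.coveringAbutsAux b o ho ω).isSome ↔ o.isSome := by
    rintro (_ | w) ho <;> simp [coveringAbutsAux]
  exact key _ rfl

/-- **The covering `𝒢_S → 𝒢` attached to ANY object `S` of `B^cov(𝒢)` lies over a PROPER morphism of
semi-graphs** ([SemiAnbd] Def 3.5 (i) p.37 with §1 p.14: verticial cardinalities of edges are
preserved): the branches of the edge-orbit `(e, ω)` are the two branches of `e` tagged by `ω`, each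
abutting to a vertex-orbit iff the underlying branch abuts to a vertex.
[cite: MochizukiSemiAnbd2006, Def 3.5(i) p.37] -/
theorem isProper_coveringHom : SemiGraph.IsProper S.coveringHom.base := by
  rintro ⟨e, ω⟩
  change 𝒢.graph.vertCard e = S.coveringSemiGraph.vertCard ⟨e, ω⟩
  symm
  refine Nat.card_congr
    { toFun := fun b => ⟨b.1.1, congrArg Sigma.fst b.2.1,
        (S.isSome_coveringAbuts_iff b.1.1 b.1.2).mp b.2.2⟩
      invFun := fun b => ⟨⟨b.1, cast (congrArg (fun e' => BTemp.Orbits (S.SE e')) b.2.1.symm) ω⟩,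
        Sigma.ext b.2.1 (by
          change HEq (cast _ ω) ω
          exact cast_heq _ ω),
        (S.isSome_coveringAbuts_iff b.1 _).mpr b.2.2⟩
      left_inv := fun b => by
        obtain ⟨⟨b₀, ω₀⟩, hb, -⟩ := b
        apply Subtype.ext
        change (⟨b₀, cast _ ω⟩ : S.coveringSemiGraph.Branch) = ⟨b₀, ω₀⟩
        have hω : HEq ω₀ ω := (Sigma.mk.inj_iff.mp hb).2
        exact Sigma.ext rfl ((cast_heq _ ω).trans hω.symm)
      right_inv := fun b => Subtype.ext rfl }

end ProfiniteSemiGraph.CovObj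

/-! ### Tempered arrows of `SgA` lie over proper morphisms of semi-graphs -/

namespace SgAQuot.SgA

open ProfiniteSemiGraph

variable {H G : SgA.{u, u, u}}

/-- **An arrow of `SgA` realised by an object of `B^cov(G.toProfinite)` lies over a proper morphism of
semi-graphs** ([SemiAnbd] Def 3.5 (i)(ii) p.37 with §1 p.14): an isomorphism over `G.toProfinite` from
the profinite reading of (a representative of) `f` to the covering `𝒢_S → 𝒢` factors the base of `f`
as an isomorphism of semi-graphs — proper (`SemiGraph.vertCard_edgeMap_of_isIso`) — followed by the
proper `CovObj.coveringHom`. [cite: MochizukiSemiAnbd2006, Def 3.5(ii) p.37] -/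
theorem isProper_of_isTemperedCoveringOf (f : H ⟶ G) (h : IsTemperedCoveringOf f) :
    SemiGraph.IsProper f.hom.hom.base := by
  obtain ⟨S, -, ⟨I⟩⟩ := h
  haveI := I.isIso_base
  intro e
  -- the base of `f` factors through the isomorphism `I.iso.base` and the covering `𝒢_S → 𝒢`
  have h₃ : f.hom.hom.base.edgeMap e = S.coveringHom.base.edgeMap (I.iso.base.edgeMap e) :=
    (congrArg (fun k : H.toSgA.graph ⟶ G.toSgA.graph => k.edgeMap e) I.base_comm).symm
  rw [h₃, S.isProper_coveringHom (I.iso.base.edgeMap e), SemiGraph.vertCard_edgeMap_of_isIso]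

/-- **Tempered arrows of `SgA` lie over proper morphisms of semi-graphs** ([SemiAnbd] Def 3.5 (ii)
p.37 via Def 2.2 (i) p.23 / Def 3.5 (i)): the finite étale ones by the first clause of
`Hom.IsFiniteEtaleCoveringOf` (abc-iut-L3-t7's `isProper_of_finiteEtale`), the others by
`isProper_of_isTemperedCoveringOf`. [cite: MochizukiSemiAnbd2006, Def 3.5(ii) p.37] -/
theorem isProper_of_isTemperedArrow (f : H ⟶ G) (h : IsTemperedArrow f) :
    SemiGraph.IsProper f.hom.hom.base :=
  h.elim (fun hfe => isProper_of_finiteEtale hfe) (isProper_of_isTemperedCoveringOf f)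

end SgAQuot.SgA

/-! ### Proposition 4.3 (iii) at `SemiAnbdVocab.real` -/

namespace Loc

open SgAQuot SgAQuot.SgA

/-- **[SemiAnbd] Prop 4.3 (iii) at the real vocabulary `SemiAnbdVocab.real`, conditional on NOTHING**:
for every totally aloof, verticially slim semi-graph of anabelioids `𝔾` (every edge abutting to a
vertex) and every `Γ ≤ Aut(𝔾)`, no morphism of `Loc(𝔾, Γ)` from a finite open object to a tempered
object is an isomorphism of semi-graphs of anabelioids — abc-iut-L3-t7's
`basicPropertiesStatementIII_ofReal_of_proper` with its single hypothesis «tempered ⇒ proper»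
discharged by `isProper_of_isTemperedArrow` at the instantiated residual `SgA.BridgeResidual.real`
(`SemiAnbdVocab.real_eq_ofReal`). [cite: MochizukiSemiAnbd2006, Prop 4.3 (iii), p. 53] -/
theorem basicPropertiesStatementIII_real (G : SgA.{u, u, u}) (Γ : Subgroup (Aut G)) :
    Literature.AnabelianGeometry.SemiGraphs.Loc.BasicPropertiesStatementIII
      SemiAnbdVocab.real.{u} G Γ :=
  basicPropertiesStatementIII_ofReal_of_proper SgA.BridgeResidual.real G Γ
    fun q hq => isProper_of_isTemperedArrow q hq

end Loc

end Literature.AnabelianGeometry.SemiGraphs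

end
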